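import Summits.ABC.IUTFork.Cor312LicenceCellThreshold
import HarnessLib

/-!
# [IUTchIII] Cor. 3.12 — the per-packet cell reads only the ADDITIVE SPAN of the possible images:
# «q-radius ≤ orbit sup-norm» ⟺ «q-radius ≤ sup-norm of the ℤ-span of the orbit» (ultrametricity)

PROOF-ONLY record file (D-0012; 0 definitions, 0 `Prop` facts) of the abc-iut cell — D-0079 RESCUE sub-cell R-H (rung LADDER-ABC:A2.RESCUE.H),
seat abc-iut-rp-d1 gen 4, k2 desk hand of ROUND-1 row 4 «hull-threshold-exact» (RH-CANDIDATES v1.2); sequel of this seat's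
`Cor312LicenceCellThreshold` (p455685/p457117). TAKES NO SIDE on [IUTchIII] Cor. 3.12 (S. Mochizuki, *Inter-universal Teichmüller theory
III*, kurims manuscript, Cor. 3.12 p. 173–174; Step (xi-f) p. 184; Rmk. 3.9.5 (i) p. 127) or on any author: statements about OUR typed hull
(S2 `holomorphicHull` / c312-7 `HullFrame.ofComparison` / c312-3 `settingDHVolSharp`); the per-packet reading is STRONGER-THAN-PRINT; nothing
here bears on the printed GLOBAL inequality. typed ≠ proved; refuted-as-typed ≠ refuted-in-print.

WHY. The exact cell criterion (`qRegion_subset_thetaHull_settingDHVolSharp_iff_exists_image`) compares the q-radius with the sup of a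
field-factor coordinate over the union `U` of the possible images — an ANALYTIC number. The k2 task of row 4 in its «saturated shell»
typing (abc-iut-lens-negation-1 `RH.SatShell.SatShellCell`) is ORBIT-SATURATION: that sup equals the coordinate radius of the content lattice
`p^{m⋆}·Λ_{v⃗}` spanned by the orbit. Step (a) of that reduction (desk memo HOME/staging/RH/rp-d1/ROW4-K2-MEMO.md §3) is recorded here:
in an ultrametric product the coordinate sups of a bounded set and of its ADDITIVE SPAN coincide, so the cell may be read on the ℤ-span of
the orbit — an ALGEBRAIC object (steps (b) «span_ℤ GL_n(ℤ_p) = M_n(ℤ_p), ⊗End = End⊗» and (c) «End(Λ)·B = content·Λ» are NOT here).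
§1 (frame level): `norm_apply_le_hullRadius_of_mem_closure` (every element of `AddSubgroup.closure V` has coordinates `≤ R_s(V)`),
`isBounded_closure_of_isBounded`, `hullRadius_closure_eq`, `preimage_hullSet_subset_hull_ofComparison_iff_exists_mem_closure`
(cell ⟺ every coordinate of the centre is dominated by an element of the ℤ-SPAN of `e(U)`).
§2 (`settingDHVolSharp`, any prime/label, `t ≠ 0`): `qRegion_subset_thetaHull_settingDHVolSharp_iff_exists_mem_closure` — the licence cell at
`(j, p)` ⟺ ∀ (v⃗,i) ∃ y in the additive span of the coordinate images of the possible images with ‖t_{q,v_j}‖ ≤ ‖y_{(v⃗,i)}‖.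
[cite: Mochizuki2012, IUTchIII Rmk. 3.9.5 (i) p. 127] [cite: DupuyHilado2025, §3.9, §4.12] [claim: Mochizuki2012, status: disputed].
-/

noncomputable section

open Set Function
open scoped Pointwise

namespace Summit.ABC.IUTFork

/-! ## §1. Frame level: coordinate sups of a bounded set and of its additive span coincide -/

namespace Cor312.HullFrame

open Literature.IUT.LogVolume

variable {J : Type} [Fintype J] (K : J → Type) [∀ j, NontriviallyNormedField (K j)]
  [∀ j, IsUltrametricDist (K j)] [∀ j, ProperSpace (K j)]

omit [∀ j, ProperSpace (K j)] in
/-- **Every element of the ADDITIVE SPAN of a bounded `V ⊆ Π_s K_s` has coordinates of norm `≤ R_s(V)`** (ultrametric inequality coordinate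
by coordinate: `‖(x+y)_s‖ ≤ max ‖x_s‖ ‖y_s‖`). [cite: DupuyHilado2025, §4.12 p. 16] -/
theorem norm_apply_le_hullRadius_of_mem_closure {V : Set (Π j, K j)} (hV : Bornology.IsBounded V) {x : Π j, K j}
    (hx : x ∈ AddSubgroup.closure V) (j : J) : ‖x j‖ ≤ hullRadius K V j := by
  induction hx using AddSubgroup.closure_induction with
  | mem y hy => exact norm_apply_le_hullRadius K hV hy j
  | zero => simpa using hullRadius_nonneg K V j
  | add y z _ _ hy hz =>
    rw [Pi.add_apply]
    exact (IsUltrametricDist.norm_add_le_max _ _).trans (max_le hy hz)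
  | neg y _ hy => simpa [Pi.neg_apply, norm_neg] using hy

omit [∀ j, ProperSpace (K j)] in
/-- The additive span of a bounded set is bounded. [folklore] -/
theorem isBounded_closure_of_isBounded {V : Set (Π j, K j)} (hV : Bornology.IsBounded V) :
    Bornology.IsBounded (AddSubgroup.closure V : Set (Π j, K j)) := by
  rw [isBounded_iff_forall_norm_le]
  refine ⟨∑ j, hullRadius K V j, fun x hx => ?_⟩
  refine (pi_norm_le_iff_of_nonneg (Finset.sum_nonneg fun j _ => hullRadius_nonneg K V j)).2 fun j => ?_
  exact (norm_apply_le_hullRadius_of_mem_closure K hV hx j).trans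
    (Finset.single_le_sum (fun k _ => hullRadius_nonneg K V k) (Finset.mem_univ j))

omit [∀ j, ProperSpace (K j)] in
/-- **The radii of a bounded set and of its additive span coincide.** [cite: DupuyHilado2025, §4.12 p. 16] -/
theorem hullRadius_closure_eq {V : Set (Π j, K j)} (hV : Bornology.IsBounded V) (j : J) :
    hullRadius K (AddSubgroup.closure V : Set (Π j, K j)) j = hullRadius K V j :=
  le_antisymm (hullRadius_le_of_nonneg K (hullRadius_nonneg K V j) fun _ hx => norm_apply_le_hullRadius_of_mem_closure K hV hx j)
    (hullRadius_mono K (isBounded_closure_of_isBounded K hV) AddSubgroup.subset_closure j)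

/-- **The cell reads only the additive span**: for a centre in the range of `e` and `e(U)` bounded nondegenerate, `e⁻¹(c·𝒪_L) ⊆ hull_e(U)`
iff every coordinate of `c` is dominated by an element of the ℤ-SPAN of `e(U)`. [cite: Mochizuki2012, IUTchIII Rmk. 3.9.5 (i) p. 127] -/
theorem preimage_hullSet_subset_hull_ofComparison_iff_exists_mem_closure {X : Type} (e : X → Π j, K j) (c : Π j, K j) (U : Set X)
    (hc : c ∈ Set.range e) (hb : Bornology.IsBounded (e '' U)) (hnd : IsNondegenerate K (e '' U)) :
    e ⁻¹' hullSet K c ⊆ (ofComparison K e).hull U ↔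
      ∀ j, ∃ y ∈ AddSubgroup.closure (e '' U), ‖c j‖ ≤ ‖y j‖ := by
  rw [preimage_hullSet_subset_hull_ofComparison_iff_hullRadius K e c U hc hb hnd]
  refine forall_congr' fun j => ⟨fun h => ?_, ?_⟩
  · obtain ⟨u, hu, hnorm, -⟩ := exists_norm_apply_eq_hullRadius K hb hnd j
    exact ⟨u, AddSubgroup.subset_closure hu, h.trans_eq hnorm.symm⟩
  · rintro ⟨y, hy, hcy⟩
    exact hcy.trans (norm_apply_le_hullRadius_of_mem_closure K hb hy j)

end Cor312.HullFrame

/-! ## §2. The sharp DH setting: the licence cell on the additive span of the possible images -/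

namespace Thm311.Real

open Cor312 Cor312.Setting Cor312Vol Cor312Vol.ExplicitDepth Literature.IUT.LogThetaLattice Literature.IUT.LogVolume
  NumberField IsDedekindDomain

variable {F : Type} [Field F] [NumberField F] (X : PilotData F) {logv : PadicLogs F} (hlog : LogvAnalytic logv)
  (M : Type) [Field M] [NumberField M]
  (archPk : ∀ (j : (thetaIndex X).Label) (vQ : (thetaIndex X).VQ), Set ((logShellsDH X logv).Packet j vQ))
  (archSub : ∀ (j : (thetaIndex X).Label) (v : (thetaIndex X).V),
    Set ((logShellsDH X logv).Packet j ((thetaIndex X).over v)))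
  (Ψ : ℤ → ∀ v : (thetaIndex X).V, v ∈ (thetaIndex X).Vbad → Set ((logShellsDH X logv).StarPacket v))
  (act : ℤ → ∀ v : (thetaIndex X).V, v ∈ (thetaIndex X).Vbad →
    (logShellsDH X logv).StarPacket v → Module.End ℚ ((logShellsDH X logv).StarPacket v))
  (Mmod : ℤ → ∀ j : (thetaIndex X).LabelStar, Set ((logShellsDH X logv).GlobalPacket j.1))
  (region : ℤ → ∀ j : (thetaIndex X).LabelStar, FinDivisor M → ∀ vQ : (thetaIndex X).VQ,
    Set ((logShellsDH X logv).Packet j.1 vQ))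
  (n : ℤ) {HT : Type} {LogLink : HT → HT → Type} {IsFull : ∀ {s t : HT}, LogLink s t → Prop}
  (lat : LGPGaussianLogThetaLattice LogLink IsFull)
  {Frd : Type} {IsoF : Frd → Frd → Type} {Ob : Frd → Type} {realify : Frd → Frd} {Strip : Type}
  {IsoS : Strip → Strip → Type} {Mv : ∀ v : (thetaIndex X).V, v ∈ (thetaIndex X).Vbad → Type}
  [∀ v h, Monoid (Mv v h)]
  (sig : GlobalLGPFrobenioidSignature (thetaIndex X).lstar (thetaIndex X).V (· ∈ (thetaIndex X).Vbad)
    Frd IsoF Ob realify Strip IsoS Mv)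
  (split : SplittingMonoids Mv) {ObΔ : Type} {N : ∀ v : (thetaIndex X).V, v ∈ (thetaIndex X).Vbad → Type}
  [∀ v h, Monoid (N v h)] (qData : QPilotData ObΔ N)
  (tq : ∀ (pp : Nat.Primes) (x : (thetaIndex X).Fibre (.inr pp)), haveI : Fact (pp : ℕ).Prime := ⟨pp.2⟩; kOf X pp.1 x)
  (t : ∀ (pp : Nat.Primes) (_ : Fin X.lstar) (x : (thetaIndex X).Fibre (.inr pp)),
    haveI : Fact (pp : ℕ).Prime := ⟨pp.2⟩; kOf X pp.1 x)
  (htq0 : ∀ pp x, tq pp x ≠ 0)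
  (htq1 : ∀ (pp : Nat.Primes) (x : (thetaIndex X).Fibre (.inr pp)),
    haveI : Fact (pp : ℕ).Prime := ⟨pp.2⟩; placeOf X pp.1 x ∉ X.S → ‖tq pp x‖ = 1)

/-- **The licence cell at `(j, p)` on the ADDITIVE SPAN of the possible images** (any prime, any label, Θ-ideles `t ≠ 0`): the q-pilot
region lies in `ⁿ˚𝒰_{j,p}` iff for every summand `v⃗` and field factor `i` some element `y` of the ℤ-span of the coordinate images of the
possible images has `‖t_{q,v_j}‖ ≤ ‖y_{(v⃗,i)}‖`. This is step (a) of the ORBIT-SATURATION reduction: the remaining steps are algebraic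
(the ℤ-span of the orbit is the content lattice). [cite: Mochizuki2012, IUTchIII Rmk. 3.9.5 (i) p. 127; Cor. 3.12 Step (xi-f) p. 184]
[claim: Mochizuki2012, status: disputed] -/
theorem qRegion_subset_thetaHull_settingDHVolSharp_iff_exists_mem_closure (ht0 : ∀ pp i x, t pp i x ≠ 0) (pp : Nat.Primes)
    (j : (thetaIndex X).Label) :
    haveI : Fact (pp : ℕ).Prime := ⟨pp.2⟩
    (settingDHVolSharp X hlog M archPk archSub Ψ act Mmod region n lat sig split qData tq t htq0 htq1).qRegion j (.inr pp) ⊆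
        (settingDHVolSharp X hlog M archPk archSub Ψ act Mmod region n lat sig split qData tq t htq0 htq1).thetaHull j (.inr pp) ↔
      ∀ (e : (thetaIndex X).Caps j → (thetaIndex X).Fibre (.inr pp)) (i : DIdx (pp : ℕ) ((presAt X hlog pp).kk e)),
        ∃ y ∈ AddSubgroup.closure (factorMapDH X hlog j (.inr pp) ''
          ⋃₀ (settingDHVolSharp X hlog M archPk archSub Ψ act Mmod region n lat sig split qData tq t htq0 htq1).possibleImages
            j (.inr pp)), ‖tq pp (e (Fin.last _))‖ ≤ ‖y ⟨e, i⟩‖ := by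
  haveI : Fact (pp : ℕ).Prime := ⟨pp.2⟩
  have hc : qCentreDH X hlog tq j (.inr pp) ∈ Set.range (factorMapDH X hlog j (.inr pp)) :=
    (presAt X hlog pp).factorMap_surjective j _
  have key := HullFrame.preimage_hullSet_subset_hull_ofComparison_iff_exists_mem_closure (factorFieldDH X hlog j (.inr pp))
    (factorMapDH X hlog j (.inr pp)) (qCentreDH X hlog tq j (.inr pp))
    (⋃₀ (settingDHVolSharp X hlog M archPk archSub Ψ act Mmod region n lat sig split qData tq t htq0 htq1).possibleImages
      j (.inr pp)) hc
    (isBounded_factorMapDH_image_sUnion_possibleImages X hlog M archPk archSub Ψ act Mmod region n lat sig split qData tq t htq0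
      htq1 pp j)
    (isNondegenerate_factorMapDH_image_sUnion_possibleImages X hlog M archPk archSub Ψ act Mmod region n lat sig split qData tq t
      htq0 htq1 ht0 pp j)
  refine key.trans ⟨fun h e i => ?_, fun h s => ?_⟩
  · obtain ⟨y, hy, hle⟩ := h ⟨e, i⟩
    exact ⟨y, hy, (norm_qCentreDH_inr X hlog tq pp j e i).symm.trans_le hle⟩
  · obtain ⟨e, i⟩ := s
    obtain ⟨y, hy, hle⟩ := h e i
    exact ⟨y, hy, (norm_qCentreDH_inr X hlog tq pp j e i).trans_le hle⟩

end Thm311.Real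

end Summit.ABC.IUTFork

end
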